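/-
Copyright (c) 2026. All rights reserved.
Released under Apache 2.0 license as described in the file LICENSE.
Authors: abc-iut cell — seat abc-iut-f-107 (F fact-proving wave, tranche 107: FACT-LIST rows F-0189 / F-0191 / F-0192;
the companion row F-0190 is `TPairsEAHomExtendsNegative.lean`).
-/
import Mathlib.CategoryTheory.InducedCategory
import Mathlib.Logic.Equiv.Bool
import Literature.AnabelianGeometry.AbsoluteAnabelian.TPairs
import Literature.AnabelianGeometry.AbsoluteAnabelian.GaloisTheatersTrivialContext
import HarnessLib

/-!
# [AbsTopIII] Cor 5.2 (iii), (iv): the schemata `ReferencePairIsoUnique`, `TPairHomDeterminedByTheaterHom`,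
# `TPairIsoCanonical` (FACT-LIST F-0189 / F-0191 / F-0192) have REFUTABLE universal closures

S. Mochizuki, *Topics in absolute anabelian geometry III: global reconstruction algorithms*, J. Math. Sci. Univ.
Tokyo 22 (2015) 939–1156 [MochizukiAbsTopIII2015], Cor 5.2 (iii) p. 119, (iv) pp. 119–120 (manuscript pages).

Negative knowledge recorded next to `TPairs.lean` (abc-iut-L4-t3), PROOF-ONLY (no `def` / `instance` / `structure` /
notation; all witnesses are built inside the proofs), abc-iut cell seat abc-iut-f-107.

The three rows are named `Prop` facts PARAMETRISED by a context `R : GlobalAnabelianContext` and a vocabulary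
`W : TPairVocabulary R T` — an axiom-free interface record whose fields (the categories `T`, `T⊚`, the canonical data
`M_{T⊚}(Π)`, `M_T(Π, v)`, `ρ_v(Π)`, and the PREDICATES "continuous action", "is an MLF-Galois / Aut-holomorphic
`T`-pair") are free.  Their docstrings say so: "an assumption on `(R, W)` true for the genuine context".  This file
supplies the kernel objects saying that the UNIVERSAL closures over `(R, W)` are false, and that no hypothesis on the
context `R` alone can rescue them: for EVERY context `R` with an object `Π ∈ Ob(EA⊚)` and every `T ≠ TLG` there is ONE
vocabulary `W⁻` and ONE global `T`-pair `M⁻` over the canonical theater `V⊚(Π)` (`TPairVocabulary.exists_schemaNegative`)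
such that

* (F-0192, Cor 5.2 (iv) essential surjectivity) `¬ TPairIsoCanonical W⁻`: the vocabulary's "continuity" predicate
  `IsContGlob` is NOT isomorphism-invariant (objects of `T⊚ := InducedCategory (Type u) Prod.fst` carry a free tag;
  the predicate reads the tag); `M⁻` lives on the twin `B = (ULift Bool, false)` of the canonical datum
  `M_{T⊚}(Π) := A = (ULift Bool, true)`, so the canonical global `T`-pair `M⊚_T(Π)` is not even an object of `Th⊚_T`;
* (F-0189, Cor 5.2 (iii) first half) `¬ ReferencePairIsoUnique W⁻`: the action on `M_{T⊚}(Π)` is trivial and the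
  restriction morphisms `ρ_v(Π)` are constant, so EVERY isomorphism `M_{T⊚}(Π) ≅ M⁻` is a reference isomorphism over
  `ψ_V = id` — in particular `ι` and `ι ≫ ν` (`ν` = Boolean negation), which differ;
* (F-0191, Cor 5.2 (iii) second half, at any `Π` WITHOUT archimedean elements — e.g. the trivial-group context) `¬
  TPairHomDeterminedByTheaterHom W⁻`: `𝟙` and `ν` are two endomorphisms of `M⁻` over the identity theater morphism.

The fully quantified closures are refuted at the trivial-group context of
`GlobalAnabelianContext.exists_trivialGroupContext` (`not_forall_referencePairIsoUnique`,
`not_forall_tPairHomDeterminedByTheaterHom`, `not_forall_tPairIsoCanonical`).  The SATISFIABILITY half (the three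
facts hold at a degenerate vocabulary) is abc-iut-w5-d058's `TPairVocabulary.exists_degenerate_tpairFacts`
(`TPairsTrivialContext.lean`).  So each row is admissible ONLY in its instance form at the genuine `(R, W)` (FACT-LIST
class «universal-closure REFUTED / schema; instance forms model-witnessed»): the typed interface does not pin the
reconstruction data of [AbsTopIII] Thm 1.9 / Cor 1.10 that make Cor 5.2 (iii), (iv) true in print.

Refereed pre-IUT anabelian geometry; bookkeeping about the cell's own interface records; nothing of [AbsTopIII] is
asserted or denied; nothing here bears on the disputed [IUTchIII] Cor. 3.12; refuted-as-typed is never a fact.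
-/

namespace Literature.AnabelianGeometry.AbsoluteAnabelian

open CategoryTheory Topology

universe u

/-- **Cor 5.2 (iii)/(iv) as typed: ONE vocabulary refutes the three schemata over EVERY context with an admissible
`Π`.**  For every `R`, `T`, and `Π ∈ Ob(EA⊚)` there are a vocabulary `W⁻` (`T = T⊚ :=` tagged types
`InducedCategory (Type u) Prod.fst`, trivial actions, constant restriction morphisms, `IsContGlob M := (tag M = false)`,
all other predicates `⊤`) and a global `T`-pair over `V⊚(Π)` (so `Th⊚_T ≠ ∅`) with: `¬ TPairIsoCanonical` (F-0192),
`¬ ReferencePairIsoUnique` (F-0189), and — if `V(Π)^arc = ∅` — `¬ TPairHomDeterminedByTheaterHom` (F-0191).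
Negative knowledge about the TYPED schema (the interface leaves `M_{T⊚}(Π)`, `ρ_v(Π)` and the predicates free); not a
statement about [AbsTopIII]. [cite: MochizukiAbsTopIII2015, Cor 5.2 (iii) p. 119] -/
theorem TPairVocabulary.exists_schemaNegative (R : GlobalAnabelianContext.{u}) (T : TKind) (hT : T ≠ .TLG)
    (E : FundamentalExtension.{u}) (hE : R.IsAdmissible E) :
    ∃ W : TPairVocabulary R T, Nonempty (GlobalTPair W) ∧ ¬ TPairIsoCanonical W hT ∧
      ¬ ReferencePairIsoUnique W hT ∧ ((∀ v, v ∉ (R.proVal E).arc) → ¬ TPairHomDeterminedByTheaterHom W hT) := by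
  -- the tagged category of types: objects `(X, b)`, morphisms `(X, b) ⟶ (X', b')` := functions `X → X'`
  let C := Type u × ULift.{u + 1} Bool
  let A : InducedCategory (Type u) (Prod.fst : C → Type u) := ((ULift.{u} Bool, ULift.up true) : C)
  let B : InducedCategory (Type u) (Prod.fst : C → Type u) := ((ULift.{u} Bool, ULift.up false) : C)
  let O : InducedCategory (Type u) (Prod.fst : C → Type u) := ((PUnit.{u + 1}, ULift.up true) : C)
  let cA : A ⟶ O := InducedCategory.homMk (TypeCat.ofHom fun _ => PUnit.unit)
  let cB : B ⟶ O := InducedCategory.homMk (TypeCat.ofHom fun _ => PUnit.unit)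
  -- the twin isomorphism `A ≅ B` (identity on `ULift Bool`) and the negation automorphism of `B`
  let ι : A ≅ B := InducedCategory.isoMk (Iso.refl _)
  let ν : B ≅ B := InducedCategory.isoMk (Equiv.ulift.trans (Equiv.boolNot.trans Equiv.ulift.symm)).toIso
  let W : TPairVocabulary R T :=
    { LocObj := InducedCategory (Type u) (Prod.fst : C → Type u)
      GlobObj := InducedCategory (Type u) (Prod.fst : C → Type u)
      toGlob := 𝟭 _
      IsContLoc := fun _ => True
      IsContGlob := fun {_} {M} _ => (M : C).2 = ULift.up false
      IsMLFGaloisPair := fun _ => True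
      KummerStr := fun _ _ => PUnit.{u + 1}
      IsAutHolPair := fun _ => True
      kummerTransport := fun _ _ _ => PUnit.unit
      kummerTransport_refl := fun _ => rfl
      globData := fun _ => A
      globAct := fun _ => 1
      locDataNon := fun _ _ => O
      locDataArc := fun _ _ => O
      locAct := fun _ _ => 1
      locKummer := fun _ _ => PUnit.unit
      locRestrictNon := fun _ _ => cA
      locRestrictArc := fun _ _ => cA
      cyclotome := fun _ => ProfiniteGrp.of PUnit.{u + 1}
      cyclotomeGrp := fun _ => ProfiniteGrp.of PUnit.{u + 1}
      IsCyclotomeCompatible := fun _ _ => True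
      IsCyclotomeArchCompatible := fun _ _ => True
      ZIndex := PEmpty.{u + 1}
      IsGeomIsoTo := fun z _ => z.elim }
  -- over `ψ_V = id`, EVERY isomorphism `ψ⊚ : M_{T⊚}(Π) = A ≅ B` satisfies Def 5.1 (v) (a)–(d) for the data
  -- `(B, trivial action, M_v := O, ρ_v := const)`: the actions are trivial and both sides of (d) are constant maps
  have href : ∀ ψ : A ≅ B,
      IsTPairReferenceFor W (R.theater E hE) B (1 : E.arith →* Aut B) (fun _ => O) (fun _ => O) (fun _ => 1)
        (fun _ => PUnit.unit) (fun _ => cB) (fun _ => cB) (Homeomorph.refl _) (fun v => v.2) (fun v => v.2) ψ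
        (fun _ => Iso.refl _) (fun _ => Iso.refl _) := by
    intro ψ
    refine ⟨fun g => ?_, fun v g hg hg' => rfl, fun v => ?_, fun v => ?_, fun v => ?_⟩
    · exact (Category.id_comp _).trans (Category.comp_id _).symm
    · exact ⟨⟨Homeomorph.refl _, RingEquiv.refl _, ContinuousMulEquiv.refl _⟩,
        ⟨1, fun a => by simp only [one_mul, inv_one, mul_one]; rfl⟩, fun _ => rfl, rfl⟩
    · exact InducedCategory.hom_ext (ConcreteCategory.hom_ext _ _ fun _ => rfl)
    · exact InducedCategory.hom_ext (ConcreteCategory.hom_ext _ _ fun _ => rfl)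
  -- the global `T`-pair `M⁻` on the twin `B` of the canonical datum, over the canonical theater `V⊚(Π)`
  let P : GlobalTPair W :=
    { theater := R.theater E hE
      M := B
      act := 1
      isCont := rfl
      Mnon := fun _ => O
      Marc := fun _ => O
      actNon := fun _ => 1
      isMLF := fun _ => trivial
      kummer := fun _ => PUnit.unit
      isAutHol := fun _ => trivial
      ρnon := fun _ => cB
      ρarc := fun _ => cB
      exists_reference := ⟨Homeomorph.refl _, R.refl_isReferenceIsoFor E, fun v => v.2, fun v => v.2, ι,
        fun _ => Iso.refl _, fun _ => Iso.refl _, href ι⟩ }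
  refine ⟨W, ⟨P⟩, fun h => ?_, fun h => ?_, fun harc h => ?_⟩
  · -- F-0192: `IsContGlob` fails on the canonical datum `A` (tag `true`)
    obtain ⟨hc, -⟩ := h P
    cases hc
  · -- F-0189: `ι` and `ι ≫ ν` are two reference isomorphisms of `M⁻` over `ψ_V = id`
    have key := (h P (Homeomorph.refl _) (R.refl_isReferenceIsoFor E) (fun v => v.2) (fun v => v.2) ι (ι ≪≫ ν)
      (fun _ => Iso.refl _) (fun _ => Iso.refl _) (fun _ => Iso.refl _) (fun _ => Iso.refl _)
      (href ι) (href (ι ≪≫ ν))).1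
    have := congrArg (fun e : A ≅ B => e.hom.hom (ULift.up true)) key
    cases this
  · -- F-0191: `𝟙` and `ν` are two endomorphisms of `M⁻` over the identity theater morphism
    let φV : GlobalGaloisTheater.Hom P.theater P.theater :=
      { φgrp := 𝟙 E
        isEAHom := isEAHom_id E
        φV := Homeomorph.refl _
        φV_smul := fun _ _ => rfl
        φV_generic := rfl
        image_non := Set.image_id _
        image_arc := Set.image_id _
        arch_compat := fun v _ => (harc v.1 v.2).elim }
    have hhom : ∀ ψ : B ≅ B, ∃ φ : GlobalTPair.Hom W P P, φ.φV = φV ∧ φ.φM = ψ := fun ψ =>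
      ⟨{ φV := φV
         φM := ψ
         φM_equivariant := fun g => (Category.id_comp _).trans (Category.comp_id _).symm
         non_mem := fun v => v.2
         arc_mem := fun v => v.2
         φnon := fun _ => Iso.refl _
         φnon_equivariant := fun v g hg hg' => rfl
         φarc := fun v => (harc v.1 v.2).elim
         φarc_kummer := fun v => (harc v.1 v.2).elim
         ρnon_comm := fun v => InducedCategory.hom_ext (ConcreteCategory.hom_ext _ _ fun _ => rfl)
         ρarc_comm := fun v => (harc v.1 v.2).elim }, rfl, rfl⟩
    obtain ⟨φ, hφV, hφM⟩ := hhom (Iso.refl _)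
    obtain ⟨φ', hφV', hφM'⟩ := hhom ν
    have key := (h P P φ φ' (hφV.trans hφV'.symm)).1
    rw [hφM, hφM'] at key
    have := congrArg (fun e : B ≅ B => e.hom.hom (ULift.up true)) key
    cases this

/-- **F-0192 (Cor 5.2 (iv), essential surjectivity `Th⊚_T ∋ M⊚ ≅ M⊚_T(Π)`), universal closure false at every context
with an admissible `Π`**: some vocabulary has a global `T`-pair not isomorphic over `𝟙 Π` to the canonical one (the
canonical one is not even an object, its "continuity" predicate failing). [cite: MochizukiAbsTopIII2015, Cor 5.2 (iv) p. 120] -/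
theorem exists_not_tPairIsoCanonical (R : GlobalAnabelianContext.{u}) (T : TKind) (hT : T ≠ .TLG)
    (E : FundamentalExtension.{u}) (hE : R.IsAdmissible E) :
    ∃ W : TPairVocabulary R T, Nonempty (GlobalTPair W) ∧ ¬ TPairIsoCanonical W hT := by
  obtain ⟨W, hW, h, -, -⟩ := TPairVocabulary.exists_schemaNegative R T hT E hE
  exact ⟨W, hW, h⟩

/-- **F-0189 (Cor 5.2 (iii), first half: uniqueness of `ψ⊚`, `ψ_v`), universal closure false at every context with an
admissible `Π`**: some vocabulary has a global `T`-pair with two distinct reference isomorphisms `ψ⊚` over the same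
`ψ_V`. [cite: MochizukiAbsTopIII2015, Cor 5.2 (iii) p. 119] -/
theorem exists_not_referencePairIsoUnique (R : GlobalAnabelianContext.{u}) (T : TKind) (hT : T ≠ .TLG)
    (E : FundamentalExtension.{u}) (hE : R.IsAdmissible E) :
    ∃ W : TPairVocabulary R T, Nonempty (GlobalTPair W) ∧ ¬ ReferencePairIsoUnique W hT := by
  obtain ⟨W, hW, -, h, -⟩ := TPairVocabulary.exists_schemaNegative R T hT E hE
  exact ⟨W, hW, h⟩

/-- **F-0191 (Cor 5.2 (iii), second half: `φ⊚`, `φ_v` determined by `φ_{V⊚}`), universal closure false at every context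
with an admissible `Π` whose `V(Π)` has no archimedean element** (e.g. the trivial-group context): some vocabulary has
a global `T`-pair with two distinct endomorphisms over the identity theater morphism. [cite: MochizukiAbsTopIII2015, Cor 5.2 (iii) p. 119] -/
theorem exists_not_tPairHomDeterminedByTheaterHom (R : GlobalAnabelianContext.{u}) (T : TKind) (hT : T ≠ .TLG)
    (E : FundamentalExtension.{u}) (hE : R.IsAdmissible E) (harc : ∀ v, v ∉ (R.proVal E).arc) :
    ∃ W : TPairVocabulary R T, Nonempty (GlobalTPair W) ∧ ¬ TPairHomDeterminedByTheaterHom W hT := by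
  obtain ⟨W, hW, -, -, h⟩ := TPairVocabulary.exists_schemaNegative R T hT E hE
  exact ⟨W, hW, h harc⟩

/-- **At the trivial-group context** (`Ob(EA⊚) = {Π = 1}`, `V⊚(Π) = {⊚}`): for every `T ≠ TLG` there are `R`, `W` at
which the three typed facts of Cor 5.2 (iii)/(iv) fail simultaneously (while abc-iut-w5-d058's degenerate vocabulary
over the same `R` satisfies them: the rows are genuine SCHEMATA in `W`). [cite: MochizukiAbsTopIII2015, Cor 5.2 (iii) p. 119] -/
theorem TPairVocabulary.exists_context_schemaNegative (T : TKind) (hT : T ≠ .TLG) :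
    ∃ (R : GlobalAnabelianContext.{u}) (W : TPairVocabulary R T), Nonempty (GlobalTPair W) ∧
      ¬ TPairIsoCanonical W hT ∧ ¬ ReferencePairIsoUnique W hT ∧ ¬ TPairHomDeterminedByTheaterHom W hT := by
  obtain ⟨R, hadm, -, -, harc⟩ := GlobalAnabelianContext.exists_trivialGroupContext.{u}
  -- the point extension `Π = G = 1`
  let E₁ : FundamentalExtension.{u} :=
    { arith := ProfiniteGrp.of PUnit.{u + 1}, gal := ProfiniteGrp.of PUnit.{u + 1},
      aug := ContinuousMonoidHom.id _, aug_surjective := Function.surjective_id }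
  have hE₁ : R.IsAdmissible E₁ := (hadm E₁).mpr (inferInstanceAs (Subsingleton PUnit))
  obtain ⟨W, hW, h₁, h₂, h₃⟩ := TPairVocabulary.exists_schemaNegative R T hT E₁ hE₁
  exact ⟨R, W, hW, h₁, h₂, h₃ (harc E₁)⟩

/-- **F-0192: the universal closure of `TPairIsoCanonical` is FALSE.** [cite: MochizukiAbsTopIII2015, Cor 5.2 (iv) p. 120] -/
theorem not_forall_tPairIsoCanonical :
    ¬ ∀ (R : GlobalAnabelianContext.{u}) (T : TKind) (W : TPairVocabulary R T) (hT : T ≠ .TLG),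
      Literature.AnabelianGeometry.AbsoluteAnabelian.TPairIsoCanonical W hT := by
  intro h
  obtain ⟨R, W, -, h₁, -, -⟩ := TPairVocabulary.exists_context_schemaNegative.{u} .TF (by decide)
  exact h₁ (h R _ W _)

/-- **F-0189: the universal closure of `ReferencePairIsoUnique` is FALSE.** [cite: MochizukiAbsTopIII2015, Cor 5.2 (iii) p. 119] -/
theorem not_forall_referencePairIsoUnique :
    ¬ ∀ (R : GlobalAnabelianContext.{u}) (T : TKind) (W : TPairVocabulary R T) (hT : T ≠ .TLG),
      Literature.AnabelianGeometry.AbsoluteAnabelian.ReferencePairIsoUnique W hT := by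
  intro h
  obtain ⟨R, W, -, -, h₂, -⟩ := TPairVocabulary.exists_context_schemaNegative.{u} .TF (by decide)
  exact h₂ (h R _ W _)

/-- **F-0191: the universal closure of `TPairHomDeterminedByTheaterHom` is FALSE.** [cite: MochizukiAbsTopIII2015, Cor 5.2 (iii) p. 119] -/
theorem not_forall_tPairHomDeterminedByTheaterHom :
    ¬ ∀ (R : GlobalAnabelianContext.{u}) (T : TKind) (W : TPairVocabulary R T) (hT : T ≠ .TLG),
      Literature.AnabelianGeometry.AbsoluteAnabelian.TPairHomDeterminedByTheaterHom W hT := by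
  intro h
  obtain ⟨R, W, -, -, -, h₃⟩ := TPairVocabulary.exists_context_schemaNegative.{u} .TF (by decide)
  exact h₃ (h R _ W _)

end Literature.AnabelianGeometry.AbsoluteAnabelian
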